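import Literature.AlgebraicGeometry.ShimuraVarieties.UnitaryAnisotropicLineFrame
import Literature.AlgebraicGeometry.ShimuraVarieties.UnitaryBallSpecialCycleNonvacuity
import Mathlib.Topology.Instances.Complex
import Mathlib.NumberTheory.NumberField.CMField
import HarnessLib

/-!
# Totally positive definite lines exist (abstract CM field, distinguished embedding)

[BergeronMillsonMoeglin2016Balls] Introduction §1.7 and Part 2 §1.1: for a hermitian space `V = L^{p+1}` over a CM
field `L` of signature `(p, 1)` at one complex place and definite at the others, the totally positive definite
subspaces `W ⊆ V` index the special cycles; in particular totally positive definite LINES exist as soon as `p ≥ 1`.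
The tree proves this for a CM subfield `E ⊆ ℂ` with distinguished embedding `E.subtype`
(★ `exists_isTotallyPositive_span_singleton`, `UnitaryBallSpecialCycleNonvacuity`); this file is the same statement
in the currency of an ABSTRACT CM number field `L` with a distinguished embedding `ι₁ : L →+* ℂ` and any conjugation
`σ` intertwined with complex conjugation by every embedding (`τ (σ x) = conj (τ x)`; e.g. `cmConjRingHom L`,
`IsCMField.complexConj L`) — the currency of the cell's hermitian data `(L, ι₁, Hm)`:

* `denseRange_of_isCMField`: every complex embedding of a CM field has dense image (its closure is a closed
  subfield of `ℂ` not contained in `ℝ`); `exists_comp_mem_of_isOpen`: `L^{n}` meets every non-empty open of `ℂⁿ`.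
* `re_embedding_hermForm_self_pos_of_posDef`: positivity `Re τ⟨w,w⟩ > 0` at EVERY `τ` from positivity at `ι₁` and
  definiteness off the place of `ι₁`; `isTotallyPositive_span_singleton_of_posDef`: such a `w` spans a totally
  positive line (★ `IsTotallyPositive`).
* **`exists_isTotallyPositive_span_singleton_of_frame`**: with a Sylvester frame `Tᴴ·H^{ι₁}·T = diag(1,…,1,−1)`
  (★ `signatureMatrix p`, `p ≥ 1`) and `H^{τ}` positive definite off the place of `ι₁`, some `w ≠ 0` spans a totally
  positive definite line `L ∙ w` — the hypothesis `W` of ★ `exists_frame_formCongr_eq_finSum_of_isTotallyPositive`.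

All proved; no definitions, no named facts.  Written for the cell `hodgecm-mathlib` (A-plan2 `GS-PROGRAMME.md` §9
A.11 (G1′): transport of (G1) to the abstract `(L, ι₁)` currency).
-/

noncomputable section

open Matrix NumberField
open scoped ComplexConjugate ComplexOrder

namespace Literature.AlgebraicGeometry.ShimuraVarieties

/-! ## §1 Density of a CM field in `ℂ` under any embedding -/

section Density

variable {L : Type*} [Field L] [NumberField L] [IsCMField L]

/-- **A complex embedding of a CM field has dense image**: the closure of `ι(L)` is a closed subfield of `ℂ`, hence
`ℝ` or `ℂ` (Mathlib `Complex.subfield_eq_of_closed`), and it is not `ℝ` because `ι` is not a real embedding (`L` is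
totally complex). [cite: BergeronMillsonMoeglin2016Balls, Part 2 §1.1] -/
theorem denseRange_of_isCMField (ι : L →+* ℂ) : DenseRange ι := by
  have hnr : ¬ ComplexEmbedding.IsReal ι := IsTotallyComplex.complexEmbedding_not_isReal _
  rw [ComplexEmbedding.isReal_iff] at hnr
  obtain ⟨x, hx⟩ : ∃ x : L, conj (ι x) ≠ ι x := by
    by_contra h
    push Not at h
    exact hnr (RingHom.ext fun x ↦ by rw [ComplexEmbedding.conjugate_coe_eq]; exact h x)
  have hrange : Set.range ι = (ι.fieldRange : Set ℂ) := by
    ext z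
    simp
  rcases Complex.subfield_eq_of_closed ι.fieldRange.isClosed_topologicalClosure with h1 | h1
  · exfalso
    have hmem : ι x ∈ ι.fieldRange.topologicalClosure :=
      ι.fieldRange.le_topologicalClosure (RingHom.mem_fieldRange.2 ⟨x, rfl⟩)
    rw [h1, RingHom.mem_fieldRange] at hmem
    obtain ⟨r, hr⟩ := hmem
    exact hx (by rw [← hr]; exact Complex.conj_ofReal r)
  · rw [DenseRange, dense_iff_closure_eq, hrange]
    have hc : ((ι.fieldRange.topologicalClosure : Subfield ℂ) : Set ℂ) = closure (ι.fieldRange : Set ℂ) := rfl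
    rw [← hc, h1]
    rfl

/-- `L^{n}` is dense in `ℂⁿ` along any embedding of the CM field `L`: every non-empty open subset of `ℂⁿ` contains
a vector `ι ∘ w` with `w ∈ Lⁿ`. [cite: BergeronMillsonMoeglin2016Balls, Part 2 §1.1] -/
theorem exists_comp_mem_of_isOpen (ι : L →+* ℂ) {n : ℕ} {O : Set (Fin n → ℂ)} (hO : IsOpen O)
    (hne : O.Nonempty) : ∃ w : Fin n → L, (⇑ι ∘ w) ∈ O := by
  have hd : Dense (Set.pi Set.univ fun _ : Fin n ↦ Set.range ι) :=
    dense_pi Set.univ fun _ _ ↦ (denseRange_of_isCMField ι)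
  obtain ⟨v, hv, hvO⟩ := hd.exists_mem_open hO hne
  choose w hw using fun i ↦ hv i (Set.mem_univ i)
  refine ⟨w, ?_⟩
  have : (⇑ι ∘ w) = v := funext fun i ↦ hw i
  rw [this]
  exact hvO

end Density

/-! ## §2 Positivity at every embedding; totally positive lines -/

section Positive

variable {L : Type*} [Field L] (σ : L →+* L)
  (hσ : ∀ (τ : L →+* ℂ) (x : L), τ (σ x) = starRingEnd ℂ (τ x)) {m : Type*} [Fintype m]
  (H : Matrix m m L) (ι₁ : L →+* ℂ)

/-- Sesquilinearity on a line: `⟨a • w, a • w⟩ = σ(a) a ⟨w, w⟩` (plumbing). [folklore] -/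
private theorem hermForm_smul_self (a : L) (w : m → L) :
    hermForm σ H (a • w) (a • w) = σ a * a * hermForm σ H w w := by
  have h1 : ⇑σ ∘ (a • w) = σ a • (⇑σ ∘ w) := by
    funext i
    simp
  rw [hermForm, hermForm, h1, mulVec_smul, dotProduct_smul, smul_dotProduct, smul_eq_mul, smul_eq_mul]
  ring

include hσ in
/-- **Positivity at every embedding from positivity at `ι₁`.** If `H^{τ}` is positive definite at every complex
embedding off the place of `ι₁`, and `w ≠ 0` is positive at `ι₁` (`Re ⟨ι₁ w, ι₁ w⟩_{H^{ι₁}} > 0`), then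
`Re τ⟨w, w⟩ > 0` for EVERY embedding `τ` (at the conjugate embedding `conj ∘ ι₁` because `Re (conj z) = Re z`).
[cite: BergeronMillsonMoeglin2016Balls, Part 2 §1.1] -/
theorem re_embedding_hermForm_self_pos_of_posDef
    (hpos : ∀ τ : L →+* ℂ, InfinitePlace.mk τ ≠ InfinitePlace.mk ι₁ → (H.map τ).PosDef)
    {w : m → L} (hw : w ≠ 0)
    (h1 : 0 < (hermForm (starRingEnd ℂ) (H.map ι₁) (⇑ι₁ ∘ w) (⇑ι₁ ∘ w)).re)
    (τ : L →+* ℂ) : 0 < (τ (hermForm σ H w w)).re := by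
  by_cases hτ : InfinitePlace.mk τ = InfinitePlace.mk ι₁
  · rcases InfinitePlace.mk_eq_iff.1 hτ with h | h
    · rw [h, map_hermForm ι₁ (hσ ι₁)]
      exact h1
    · have hτ' : ∀ x, τ x = conj (ι₁ x) := fun x ↦ by
        rw [← h, ComplexEmbedding.conjugate_coe_eq, Complex.conj_conj]
      rw [hτ', Complex.conj_re, map_hermForm ι₁ (hσ ι₁)]
      exact h1
  · have hne : (⇑τ ∘ w) ≠ 0 := by
      obtain ⟨i, hi⟩ := Function.ne_iff.1 hw
      intro h
      exact hi (by simpa using congr_fun h i)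
    have h2 := (hpos τ hτ).re_dotProduct_pos hne
    rw [map_hermForm τ (hσ τ), hermForm_starRingEnd]
    simpa using h2

include hσ in
/-- **A positive vector spans a totally positive line**: with `H` definite off the place of `ι₁`, if `w ≠ 0` is
positive at `ι₁` then `L ∙ w` is totally positive definite (`⟨a w, a w⟩ = |a|² ⟨w, w⟩` at each embedding).
[cite: BergeronMillsonMoeglin2016Balls, Introduction §1.7] -/
theorem isTotallyPositive_span_singleton_of_posDef
    (hpos : ∀ τ : L →+* ℂ, InfinitePlace.mk τ ≠ InfinitePlace.mk ι₁ → (H.map τ).PosDef)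
    {w : m → L} (hw : w ≠ 0)
    (h1 : 0 < (hermForm (starRingEnd ℂ) (H.map ι₁) (⇑ι₁ ∘ w) (⇑ι₁ ∘ w)).re) :
    IsTotallyPositive σ H (L ∙ w) := by
  intro w' hw' hne τ
  obtain ⟨a, rfl⟩ := Submodule.mem_span_singleton.1 hw'
  have ha : a ≠ 0 := by
    rintro rfl
    exact hne (zero_smul _ _)
  rw [hermForm_smul_self, map_mul, map_mul, hσ, ← Complex.normSq_eq_conj_mul_self, Complex.re_ofReal_mul]
  exact mul_pos (Complex.normSq_pos.2 ((map_ne_zero τ).2 ha))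
    (re_embedding_hermForm_self_pos_of_posDef σ hσ H ι₁ hpos hw h1 τ)

end Positive

/-! ## §3 Existence of a totally positive definite line -/

section Existence

variable {L : Type*} [Field L] [NumberField L] [IsCMField L] (σ : L →+* L)
  (hσ : ∀ (τ : L →+* ℂ) (x : L), τ (σ x) = starRingEnd ℂ (τ x)) {p : ℕ}

include hσ in
/-- **Totally positive definite lines exist** (abstract CM field, distinguished embedding).  Let `L` be a CM field,
`ι₁ : L →+* ℂ`, `σ` a conjugation of `L` intertwined with complex conjugation by every embedding, and `H` a Gram
matrix on `L^{p+1}`, `p ≥ 1`, with a Sylvester frame `Tᴴ·H^{ι₁}·T = diag(1,…,1,−1)` at `ι₁` and `H^{τ}` positive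
definite at every embedding `τ` off the place of `ι₁`.  Then some `w ≠ 0` in `L^{p+1}` spans a totally positive
definite line `L ∙ w` (the positive cone at `ι₁` is open and contains the first frame vector; `ι₁(L)^{p+1}` is dense in
`ℂ^{p+1}`). [cite: BergeronMillsonMoeglin2016Balls, Introduction §1.7] -/
theorem exists_isTotallyPositive_span_singleton_of_frame (hp : 0 < p) (H : Matrix (Fin (p + 1)) (Fin (p + 1)) L)
    (ι₁ : L →+* ℂ)
    (hsig : ∃ T : GL (Fin (p + 1)) ℂ,
      (T : Matrix (Fin (p + 1)) (Fin (p + 1)) ℂ)ᴴ * H.map ι₁ * (T : Matrix (Fin (p + 1)) (Fin (p + 1)) ℂ) =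
        signatureMatrix p)
    (hpos : ∀ τ : L →+* ℂ, InfinitePlace.mk τ ≠ InfinitePlace.mk ι₁ → (H.map τ).PosDef) :
    ∃ w : Fin (p + 1) → L, w ≠ 0 ∧ IsTotallyPositive σ H (L ∙ w) := by
  obtain ⟨T, hT⟩ := hsig
  -- the open positive cone at `ι₁`
  set O : Set (Fin (p + 1) → ℂ) :=
    {v | 0 < (hermForm (starRingEnd ℂ) (H.map ι₁) v v).re} with hO_def
  have hO : IsOpen O :=
    isOpen_lt continuous_const (Complex.continuous_re.comp
      ((continuous_pi fun i ↦ (continuous_apply i).star).dotProduct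
        (continuous_const.matrix_mulVec continuous_id)))
  -- it contains the first frame vector
  have ht : (fun i ↦ (T : Matrix (Fin (p + 1)) (Fin (p + 1)) ℂ) i 0) ∈ O := by
    show 0 < (hermForm (starRingEnd ℂ) (H.map ι₁) _ _).re
    rw [hermForm_col_zero hp hT, Complex.one_re]
    exact one_pos
  -- density of `ι₁(L)^{p+1}`
  obtain ⟨w, hwO⟩ := exists_comp_mem_of_isOpen ι₁ hO ⟨_, ht⟩
  have hw : w ≠ 0 := by
    rintro rfl
    have h0 : (⇑ι₁ ∘ (0 : Fin (p + 1) → L)) = 0 := by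
      funext i
      simp
    rw [hO_def, Set.mem_setOf_eq, h0] at hwO
    simp only [hermForm_starRingEnd, star_zero, zero_dotProduct, Complex.zero_re, lt_self_iff_false] at hwO
  exact ⟨w, hw, isTotallyPositive_span_singleton_of_posDef σ hσ H ι₁ hpos hw hwO⟩

include hσ in
/-- The same with the frame given in the tree's `formCongr` spelling over `ℂ` (`ᵗconj(T)·H^{ι₁}·T = diag(1,…,1,−1)`,
as carried by the cell's hermitian data). [cite: BergeronMillsonMoeglin2016Balls, Introduction §1.7] -/
theorem exists_isTotallyPositive_span_singleton_of_formCongr (hp : 0 < p)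
    (H : Matrix (Fin (p + 1)) (Fin (p + 1)) L) (ι₁ : L →+* ℂ)
    (hsig : ∃ T : GL (Fin (p + 1)) ℂ,
      Literature.NumberTheory.Automorphic.formCongr (starRingEnd ℂ) T (H.map ι₁) = signatureMatrix p)
    (hpos : ∀ τ : L →+* ℂ, InfinitePlace.mk τ ≠ InfinitePlace.mk ι₁ → (H.map τ).PosDef) :
    ∃ w : Fin (p + 1) → L, w ≠ 0 ∧ IsTotallyPositive σ H (L ∙ w) := by
  obtain ⟨T, hT⟩ := hsig
  refine exists_isTotallyPositive_span_singleton_of_frame σ hσ hp H ι₁ ⟨T, ?_⟩ hpos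
  rw [← hT]
  rfl

end Existence

end Literature.AlgebraicGeometry.ShimuraVarieties

end
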